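import Summits.QuantumFields.YangMills.Theorems.SwapVirialDeficitSectorLaplaceHubCotLetters
import Summits.QuantumFields.YangMills.Theorems.SwapVirialDeficitSectorLaplacePlaneParts
import Summits.QuantumFields.YangMills.Theorems.SwapVirialDeficitSectorLaplaceBTubeFibred
import HarnessLib

/-!
# STUB (S-B) OF SKELETON ➎: READING THE B-TUBE INTEGRALS ON `chartMeasure L` AS WINDOW-CYLINDER INTEGRALS AGAINST `μ_B` (the hub is the letter `δ`)
# (free-hands support of ⟨stmt-QuantumFields-24197⟩ `SwapVirialDeficit.SwapGluedStiffness` ∕ ⟨24194⟩; cell ym-idea-1, LEAD memo7 §E(3); g47's skeleton ➎ v3 `stub_B_stiff` is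
# stated on `chartMeasure L` over ✓`BTube L τ`, the B-law ✓`bTube_fibred_scaled_cylinder_uniform` on `X = ℝ × GnoCoord L` against `μ_B`)

* §1 null sets: `volume_im_eq_zero` (the real axis `{a | im a = 0}` is Lebesgue-null in `ℍ`, Mathlib ✓`Measure.addHaar_submodule`), `coneMeasure_im_eq_zero`,
  `chartMeasure_im_eq_zero`, `ae_im_ne_zero_chartMeasure`;
* §2 ★ `lintegral_chartMeasure_hubCot_muB` — `∫ H(re a∕‖im a‖, η) d(chartMeasure) = coneConst·π·∫ H dμ_B` with `μ_B = vol·((1+δ²)⁻¹)²ρ(η)` on `ℝ × GnoCoord L`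
  (✓`lintegral_chartMeasure_hubCot` + Mathlib ✓`prod_withDensity_right`);
* §3 letters of the B-tube: `norm_eq_norm_im_mul_sqrt` (`‖a‖ = ‖im a‖√(1+δ²)`), ★ `mem_BTube_iff_cot` — for `im a ≠ 0`,
  `(a, η) ∈ BTube L τ ↔ (4δ²∕(1+δ²)² < τ ∧ τ ≤ (1+δ²)⁻¹ ∧ |δ| < τ√(1+δ²)) ∧ τ ≤ √(η_x1² + η_x2²)` (✓`hubS1_eq_cot`, ✓`hubS2_eq_cot`), `measurableSet_BTube`,
  `measurableSet_bWindowCylinder`;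
* §4 ★★★ `setLIntegral_BTube_eq_hubCot (z χ ε τ) (g) (hg)` — for every measurable `g : ℝ → ℝ≥0∞`:
  `∫⁻_{BTube L τ} g(F̂_{z,χ}(a, ε, η)) d(chartMeasure) = coneConst·π · ∫⁻_{{δ ∈ W_τ} ∩ {τ ≤ |u|}} g(F̂_{z,χ}(hubAt δ 1, ε, η)) dμ_B(δ, η)`
  (✓`gnoDeficit_eq_hubCot` off the cone-null real axis); ★★ `setIntegral_BTube_exp_eq_hubCot`, ★★ `setIntegral_BTube_action_eq_hubCot` — the two Bochner integrals of
  g47's `stub_B_stiff` (`e^{−bF̂}` and `F̂e^{−bF̂}`) as `coneConst·π` times the window-cylinder integrals against `μ_B` that ✓`bTube_fibred_scaled_cylinder_uniform` evaluates.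

HONEST LABEL: measure-theoretic reading only; (S-B) is NOT closed (far floor; log-law ∕ action step); (S-core), (S-001), ⟨24197⟩ ∕ ⟨24194⟩ OPEN; own crux ⟨22884⟩ OPEN
(blocked-on ⟨19935⟩); the Yang–Mills mass gap is NOT proved; no summit is proved by a line.  THEOREMS ONLY (0 `def`, 0 `sorry`), standard axioms; the
`attribute [local instance]` block is the series' measurable structure on `ℍ` (as in ✓`SectorLaplaceDefs`; nothing overridden).  Width seat ym-line-sfw-p2-w2 g59
(cell ym-idea-1, free hands), `--supports stmt-QuantumFields-24197`.  References: [folklore].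
-/

set_option autoImplicit false
set_option synthInstance.maxSize 1024

noncomputable section

open MeasureTheory Quaternion Set
open scoped Quaternion ENNReal BigOperators
open Literature.MathematicalPhysics.QuantumLattice
open Literature.MathematicalPhysics.QuantumFieldTheory hiding SU2
open Summit.QuantumFields.YangMills.Theorems.SwapTwistDeficit.ToronLog

attribute [local instance] Literature.Analysis.FluidPDE.Tao2016.quatMeasurableSpace
  Literature.Analysis.FluidPDE.Tao2016.quatBorelSpace
  Literature.MathematicalPhysics.QuantumLattice.secondCountableTopology_su2

namespace Summit.QuantumFields.YangMills.Theorems.SwapVirialDeficit.BlowUpRing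

open Summit.QuantumFields.YangMills.Theorems.FemtoTransferGap
open Summit.QuantumFields.YangMills.Theorems.FemtoTransferGap.TT
open Summit.QuantumFields.YangMills.Theorems.VirialFluxGap.RingDeficit
open Summit.QuantumFields.YangMills.Theorems.SwapVirialDeficit.SectorLaplace

variable {L : ℕ} [NeZero L]

/-! ## §1 The real axis of `ℍ` is null -/

omit [NeZero L] in
/-- The real axis `{a : ℍ | im a = 0}` is Lebesgue-null (a strict subspace, Mathlib ✓`Measure.addHaar_submodule`). [folklore] -/
theorem volume_im_eq_zero : (volume : Measure ℍ) {a : ℍ | a.im = 0} = 0 := by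
  have hsub : {a : ℍ | a.im = 0} ⊆ ((Submodule.span ℝ {(1 : ℍ)} : Submodule ℝ ℍ) : Set ℍ) := by
    intro a ha
    rw [SetLike.mem_coe, Submodule.mem_span_singleton]
    refine ⟨a.re, ?_⟩
    have hI : a.imI = 0 := by have h := congrArg QuaternionAlgebra.imI ha; simpa using h
    have hJ : a.imJ = 0 := by have h := congrArg QuaternionAlgebra.imJ ha; simpa using h
    have hK : a.imK = 0 := by have h := congrArg QuaternionAlgebra.imK ha; simpa using h
    ext <;> simp [hI, hJ, hK]
  have hne : (Submodule.span ℝ {(1 : ℍ)} : Submodule ℝ ℍ) ≠ ⊤ := by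
    intro h
    have hmem : hubAt 0 1 ∈ (Submodule.span ℝ {(1 : ℍ)} : Submodule ℝ ℍ) := by rw [h]; exact Submodule.mem_top
    rw [Submodule.mem_span_singleton] at hmem
    obtain ⟨c, hc⟩ := hmem
    have h1 := congrArg QuaternionAlgebra.imI hc
    simp [hubAt] at h1
  exact measure_mono_null hsub (Measure.addHaar_submodule volume _ hne)

omit [NeZero L] in
/-- The real axis is cone-null. [folklore] -/
theorem coneMeasure_im_eq_zero : coneMeasure {a : ℍ | a.im = 0} = 0 := by
  rw [coneMeasure, Measure.smul_apply, Measure.restrict_apply' Metric.isOpen_ball.measurableSet, smul_eq_mul]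
  have h : volume ({a : ℍ | a.im = 0} ∩ Metric.ball (0 : ℍ) 1) = 0 := measure_mono_null Set.inter_subset_left volume_im_eq_zero
  rw [h, mul_zero]

/-- `{x | im x.1 = 0}` is null for the chart measure. [folklore] -/
theorem chartMeasure_im_eq_zero : chartMeasure L {x : ℍ × GnoCoord L | x.1.im = 0} = 0 := by
  haveI : SFinite (fibreMeasure L) := by unfold fibreMeasure; infer_instance
  have e : {x : ℍ × GnoCoord L | x.1.im = 0} = {a : ℍ | a.im = 0} ×ˢ (univ : Set (GnoCoord L)) := by
    ext x; simp
  unfold chartMeasure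
  rw [e, Measure.prod_prod, coneMeasure_im_eq_zero, zero_mul]

/-- Almost every chart point has a hub off the real axis. [folklore] -/
theorem ae_im_ne_zero_chartMeasure : ∀ᵐ x ∂chartMeasure L, x.1.im ≠ 0 := by
  rw [ae_iff]
  have e : {x : ℍ × GnoCoord L | ¬x.1.im ≠ 0} = {x : ℍ × GnoCoord L | x.1.im = 0} := by ext x; simp
  rw [e]
  exact chartMeasure_im_eq_zero

/-! ## §2 The chart measure in the letters `(δ, η)` is `coneConst·π·μ_B` -/

/-- ★ `∫ H(re a ∕ ‖im a‖, η) d(chartMeasure) = coneConst·π · ∫ H dμ_B`, `μ_B = vol·((1+δ²)⁻¹)²ρ(η)` on `ℝ × GnoCoord L`. [folklore] -/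
theorem lintegral_chartMeasure_hubCot_muB (H : ℝ × GnoCoord L → ℝ≥0∞) (hH : Measurable H) :
    ∫⁻ x, H (x.1.re / ‖x.1.im‖, x.2) ∂(chartMeasure L) =
      ENNReal.ofReal (coneConst * Real.pi) *
        ∫⁻ p, H p ∂((volume : Measure (ℝ × GnoCoord L)).withDensity fun p => ENNReal.ofReal (((1 + p.1 ^ 2)⁻¹) ^ 2 * gnoDensity p.2)) := by
  rw [lintegral_chartMeasure_hubCot H hH]
  congr 1
  have hρ : Measurable fun η : GnoCoord L => ENNReal.ofReal (gnoDensity η) := ENNReal.measurable_ofReal.comp measurable_gnoDensity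
  have hρ2 : Measurable fun z : ℝ × GnoCoord L => ENNReal.ofReal (gnoDensity z.2) := hρ.comp measurable_snd
  have hw : Measurable fun q : ℝ × GnoCoord L => ENNReal.ofReal (((1 + q.1 ^ 2)⁻¹) ^ 2) :=
    ENNReal.measurable_ofReal.comp (((measurable_const.add (measurable_fst.pow_const 2)).inv).pow_const 2)
  have hHw : Measurable fun q : ℝ × GnoCoord L => H q * ENNReal.ofReal (((1 + q.1 ^ 2)⁻¹) ^ 2) := hH.mul hw
  have hJ : Measurable fun p : ℝ × GnoCoord L => ENNReal.ofReal (((1 + p.1 ^ 2)⁻¹) ^ 2 * gnoDensity p.2) := ENNReal.measurable_ofReal.comp measurable_bDensity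
  unfold fibreMeasure
  rw [prod_withDensity_right hρ, lintegral_withDensity_eq_lintegral_mul _ hρ2 hHw, lintegral_withDensity_eq_lintegral_mul _ hJ hH, Measure.volume_eq_prod]
  refine lintegral_congr fun q => ?_
  simp only [Pi.mul_apply]
  rw [ENNReal.ofReal_mul (by positivity)]
  ring

/-! ## §3 The B-tube in the letters `(δ, η)` -/

omit [NeZero L] in
/-- `‖a‖ = ‖im a‖·√(1 + δ²)`, `δ = re a ∕ ‖im a‖` (`im a ≠ 0`). [folklore] -/
theorem norm_eq_norm_im_mul_sqrt {a : ℍ} (him : a.im ≠ 0) : ‖a‖ = ‖a.im‖ * Real.sqrt (1 + (a.re / ‖a.im‖) ^ 2) := by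
  have hi : 0 < ‖a.im‖ := norm_pos_iff.2 him
  have hn2 : ‖a‖ ^ 2 = a.re ^ 2 + ‖a.im‖ ^ 2 := by
    have h1 : ‖a‖ ^ 2 = Quaternion.normSq a := by rw [Quaternion.normSq_eq_norm_mul_self, sq]
    rw [h1, Quaternion.normSq_def', WeakCouplingRates.sq_norm_im]; ring
  have h2 : (‖a.im‖ * Real.sqrt (1 + (a.re / ‖a.im‖) ^ 2)) ^ 2 = a.re ^ 2 + ‖a.im‖ ^ 2 := by
    rw [mul_pow, Real.sq_sqrt (by positivity)]
    field_simp
    ring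
  have h3 : 0 ≤ ‖a.im‖ * Real.sqrt (1 + (a.re / ‖a.im‖) ^ 2) := by positivity
  rw [← hn2] at h2
  exact ((sq_eq_sq₀ (norm_nonneg a) h3).1 h2.symm)

omit [NeZero L] in
/-- `|re a| < τ‖a‖ ↔ |δ| < τ√(1+δ²)` (`im a ≠ 0`). [folklore] -/
theorem abs_re_lt_iff_cot {a : ℍ} (him : a.im ≠ 0) (τ : ℝ) : |a.re| < τ * ‖a‖ ↔ |a.re / ‖a.im‖| < τ * Real.sqrt (1 + (a.re / ‖a.im‖) ^ 2) := by
  have hi : 0 < ‖a.im‖ := norm_pos_iff.2 him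
  rw [norm_eq_norm_im_mul_sqrt him, abs_div, abs_of_pos hi, div_lt_iff₀ hi]
  constructor <;> intro h <;> nlinarith [h]

omit [NeZero L] in
/-- ★ **THE B-TUBE IN THE LETTERS `(δ, η)`**: for `im a ≠ 0`,
`(a, η) ∈ BTube L τ ↔ (4δ²∕(1+δ²)² < τ ∧ τ ≤ (1+δ²)⁻¹ ∧ |δ| < τ√(1+δ²)) ∧ τ ≤ √(η_x1² + η_x2²)`, `δ = re a ∕ ‖im a‖`. [folklore] -/
theorem mem_BTube_iff_cot {a : ℍ} (him : a.im ≠ 0) (η : GnoCoord L) (τ : ℝ) :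
    (a, η) ∈ BTube L τ ↔
      (4 * (a.re / ‖a.im‖) ^ 2 / (1 + (a.re / ‖a.im‖) ^ 2) ^ 2 < τ ∧ τ ≤ (1 + (a.re / ‖a.im‖) ^ 2)⁻¹ ∧
          |a.re / ‖a.im‖| < τ * Real.sqrt (1 + (a.re / ‖a.im‖) ^ 2)) ∧
        τ ≤ Real.sqrt (η.1.1 1 ^ 2 + η.1.1 2 ^ 2) := by
  simp only [BTube, EndHub, mem_setOf_eq]
  rw [hubS1_eq_cot him, hubS2_eq_cot him, abs_re_lt_iff_cot him]
  tauto

omit [NeZero L] in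
/-- `BTube L τ` is measurable. [folklore] -/
theorem measurableSet_BTube (τ : ℝ) : MeasurableSet (BTube L τ) := by
  have e : BTube L τ = {x : ℍ × GnoCoord L | x.1 ∈ EndHub τ} ∩ ({x : ℍ × GnoCoord L | |x.1.re| < τ * ‖x.1‖} ∩
      {x : ℍ × GnoCoord L | τ ≤ Real.sqrt (x.2.1.1 1 ^ 2 + x.2.1.1 2 ^ 2)}) := by
    ext x; simp only [BTube, mem_setOf_eq, mem_inter_iff]
  rw [e]
  have h1 : Measurable fun x : ℍ × GnoCoord L => |x.1.re| := (Quaternion.continuous_re.measurable.comp measurable_fst).abs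
  have h2 : Measurable fun x : ℍ × GnoCoord L => τ * ‖x.1‖ := measurable_const.mul measurable_fst.norm
  have h3 : Measurable fun x : ℍ × GnoCoord L => Real.sqrt (x.2.1.1 1 ^ 2 + x.2.1.1 2 ^ 2) :=
    ((((measurable_pi_apply 1).comp (measurable_fst.comp (measurable_fst.comp measurable_snd))).pow_const 2).add
      (((measurable_pi_apply 2).comp (measurable_fst.comp (measurable_fst.comp measurable_snd))).pow_const 2)).sqrt
  exact (measurable_fst (measurableSet_endHub τ)).inter ((measurableSet_lt h1 h2).inter (measurableSet_le measurable_const h3))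

omit [NeZero L] in
/-- The window-cylinder `{δ ∈ W_τ} ∩ {τ ≤ √(η_x1² + η_x2²)}` is measurable. [folklore] -/
theorem measurableSet_bWindowCylinder (τ : ℝ) :
    MeasurableSet ({p : ℝ × GnoCoord L | 4 * p.1 ^ 2 / (1 + p.1 ^ 2) ^ 2 < τ ∧ τ ≤ (1 + p.1 ^ 2)⁻¹ ∧ |p.1| < τ * Real.sqrt (1 + p.1 ^ 2)} ∩
      {p : ℝ × GnoCoord L | τ ≤ Real.sqrt (p.2.1.1 1 ^ 2 + p.2.1.1 2 ^ 2)}) := by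
  have h1 : Measurable fun p : ℝ × GnoCoord L => p.1 := measurable_fst
  have ha : Measurable fun p : ℝ × GnoCoord L => 4 * p.1 ^ 2 / (1 + p.1 ^ 2) ^ 2 :=
    ((h1.pow_const 2).const_mul 4).div ((measurable_const.add (h1.pow_const 2)).pow_const 2)
  have hb : Measurable fun p : ℝ × GnoCoord L => (1 + p.1 ^ 2)⁻¹ := (measurable_const.add (h1.pow_const 2)).inv
  have hc : Measurable fun p : ℝ × GnoCoord L => |p.1| := h1.abs
  have hd : Measurable fun p : ℝ × GnoCoord L => τ * Real.sqrt (1 + p.1 ^ 2) := measurable_const.mul (measurable_const.add (h1.pow_const 2)).sqrt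
  have he : Measurable fun p : ℝ × GnoCoord L => Real.sqrt (p.2.1.1 1 ^ 2 + p.2.1.1 2 ^ 2) :=
    ((((measurable_pi_apply 1).comp (measurable_fst.comp (measurable_fst.comp measurable_snd))).pow_const 2).add
      (((measurable_pi_apply 2).comp (measurable_fst.comp (measurable_fst.comp measurable_snd))).pow_const 2)).sqrt
  exact ((measurableSet_lt ha measurable_const).inter ((measurableSet_le measurable_const hb).inter (measurableSet_lt hc hd))).inter
    (measurableSet_le measurable_const he)

/-! ## §4 The B-tube integrals as window-cylinder integrals against `μ_B` -/

/-- ★★★ **THE B-TUBE INTEGRALS IN THE LETTERS `(δ, η)`**: for every measurable `g : ℝ → ℝ≥0∞`, sector `z`, character `χ`, signs `ε` and cut `τ`,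
`∫⁻_{BTube L τ} g(F̂(a, ε, η)) d(chartMeasure) = coneConst·π · ∫⁻_{{δ ∈ W_τ} ∩ {τ ≤ √(η_x1²+η_x2²)}} g(F̂(hubAt δ 1, ε, η)) dμ_B(δ, η)`
(✓`gnoDeficit_eq_hubCot` and `mem_BTube_iff_cot` off the cone-null real axis, then `lintegral_chartMeasure_hubCot_muB`). [folklore] -/
theorem setLIntegral_BTube_eq_hubCot (z : Fin 3 → Bool) (χ : Site 3 L → SU2) (ε : GnoSign L) (τ : ℝ) (g : ℝ → ℝ≥0∞) (hg : Measurable g) :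
    ∫⁻ x in BTube L τ, g (gnoDeficit z χ x.1 ε x.2) ∂(chartMeasure L) =
      ENNReal.ofReal (coneConst * Real.pi) *
        ∫⁻ p in {p : ℝ × GnoCoord L | 4 * p.1 ^ 2 / (1 + p.1 ^ 2) ^ 2 < τ ∧ τ ≤ (1 + p.1 ^ 2)⁻¹ ∧ |p.1| < τ * Real.sqrt (1 + p.1 ^ 2)} ∩
            {p : ℝ × GnoCoord L | τ ≤ Real.sqrt (p.2.1.1 1 ^ 2 + p.2.1.1 2 ^ 2)},
          g (gnoDeficit z χ (hubAt p.1 1) ε p.2)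
          ∂((volume : Measure (ℝ × GnoCoord L)).withDensity fun p => ENNReal.ofReal (((1 + p.1 ^ 2)⁻¹) ^ 2 * gnoDensity p.2)) := by
  set Rg : Set (ℝ × GnoCoord L) := {p : ℝ × GnoCoord L | 4 * p.1 ^ 2 / (1 + p.1 ^ 2) ^ 2 < τ ∧ τ ≤ (1 + p.1 ^ 2)⁻¹ ∧ |p.1| < τ * Real.sqrt (1 + p.1 ^ 2)} ∩
    {p : ℝ × GnoCoord L | τ ≤ Real.sqrt (p.2.1.1 1 ^ 2 + p.2.1.1 2 ^ 2)} with hRg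
  have hRgm : MeasurableSet Rg := measurableSet_bWindowCylinder τ
  set H : ℝ × GnoCoord L → ℝ≥0∞ := Rg.indicator fun p => g (gnoDeficit z χ (hubAt p.1 1) ε p.2) with hHdef
  have hHm : Measurable H := (hg.comp (measurable_bDeficit z χ ε)).indicator hRgm
  rw [← lintegral_indicator (measurableSet_BTube τ), ← lintegral_indicator hRgm]
  -- a.e. the two indicators agree in the letters `(δ, η)`
  have hae : (fun x : ℍ × GnoCoord L => (BTube L τ).indicator (fun x => g (gnoDeficit z χ x.1 ε x.2)) x) =ᵐ[chartMeasure L]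
      fun x : ℍ × GnoCoord L => H (x.1.re / ‖x.1.im‖, x.2) := by
    filter_upwards [ae_im_ne_zero_chartMeasure (L := L)] with x him
    have hmem : x ∈ BTube L τ ↔ (x.1.re / ‖x.1.im‖, x.2) ∈ Rg := by
      rw [hRg, show x = (x.1, x.2) from rfl, mem_BTube_iff_cot him]
      simp only [mem_inter_iff, mem_setOf_eq]
    by_cases hx : x ∈ BTube L τ
    · rw [indicator_of_mem hx, hHdef, indicator_of_mem (hmem.1 hx), gnoDeficit_eq_hubCot z χ him]
    · rw [indicator_of_notMem hx, hHdef, indicator_of_notMem (fun h => hx (hmem.2 h))]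
  rw [lintegral_congr_ae hae, lintegral_chartMeasure_hubCot_muB H hHm]

/-- ★★ **THE B-TUBE PARTITION FUNCTION IN THE LETTERS `(δ, η)`** (the left side of g47's `stub_B_stiff`):
`∫_{BTube L τ} e^{−bF̂(a,ε,η)} d(chartMeasure) = coneConst·π · ∫_{{δ ∈ W_τ} ∩ {τ ≤ |u|}} e^{−bF̂(hubAt δ 1, ε, η)} dμ_B`. [folklore] -/
theorem setIntegral_BTube_exp_eq_hubCot (z : Fin 3 → Bool) (χ : Site 3 L → SU2) (ε : GnoSign L) (τ b : ℝ) :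
    ∫ x in BTube L τ, Real.exp (-(b * gnoDeficit z χ x.1 ε x.2)) ∂(chartMeasure L) =
      coneConst * Real.pi *
        ∫ p in {p : ℝ × GnoCoord L | 4 * p.1 ^ 2 / (1 + p.1 ^ 2) ^ 2 < τ ∧ τ ≤ (1 + p.1 ^ 2)⁻¹ ∧ |p.1| < τ * Real.sqrt (1 + p.1 ^ 2)} ∩
            {p : ℝ × GnoCoord L | τ ≤ Real.sqrt (p.2.1.1 1 ^ 2 + p.2.1.1 2 ^ 2)},
          Real.exp (-(b * gnoDeficit z χ (hubAt p.1 1) ε p.2))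
          ∂((volume : Measure (ℝ × GnoCoord L)).withDensity fun p => ENNReal.ofReal (((1 + p.1 ^ 2)⁻¹) ^ 2 * gnoDensity p.2)) := by
  have hm1 : Measurable fun x : ℍ × GnoCoord L => Real.exp (-(b * gnoDeficit z χ x.1 ε x.2)) :=
    ((measurable_gnoDeficit_uncurry z χ ε).const_mul b).neg.exp
  have hm2 : Measurable fun p : ℝ × GnoCoord L => Real.exp (-(b * gnoDeficit z χ (hubAt p.1 1) ε p.2)) :=
    ((measurable_bDeficit z χ ε).const_mul b).neg.exp
  rw [integral_eq_lintegral_of_nonneg_ae (Filter.Eventually.of_forall fun x => (Real.exp_pos _).le) hm1.aestronglyMeasurable.restrict,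
    integral_eq_lintegral_of_nonneg_ae (Filter.Eventually.of_forall fun x => (Real.exp_pos _).le) hm2.aestronglyMeasurable.restrict]
  have h := setLIntegral_BTube_eq_hubCot z χ ε τ (fun t => ENNReal.ofReal (Real.exp (-(b * t)))) (by fun_prop)
  rw [h, ENNReal.toReal_mul, ENNReal.toReal_ofReal (mul_pos coneConst_pos Real.pi_pos).le]

/-- ★★ **THE B-TUBE ACTION INTEGRAL IN THE LETTERS `(δ, η)`** (the right side of g47's `stub_B_stiff`):
`∫_{BTube L τ} F̂e^{−bF̂} d(chartMeasure) = coneConst·π · ∫_{{δ ∈ W_τ} ∩ {τ ≤ |u|}} F̂(hubAt δ 1, ε, η)e^{−bF̂(hubAt δ 1, ε, η)} dμ_B`. [folklore] -/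
theorem setIntegral_BTube_action_eq_hubCot (z : Fin 3 → Bool) (χ : Site 3 L → SU2) (ε : GnoSign L) (τ b : ℝ) :
    ∫ x in BTube L τ, gnoDeficit z χ x.1 ε x.2 * Real.exp (-(b * gnoDeficit z χ x.1 ε x.2)) ∂(chartMeasure L) =
      coneConst * Real.pi *
        ∫ p in {p : ℝ × GnoCoord L | 4 * p.1 ^ 2 / (1 + p.1 ^ 2) ^ 2 < τ ∧ τ ≤ (1 + p.1 ^ 2)⁻¹ ∧ |p.1| < τ * Real.sqrt (1 + p.1 ^ 2)} ∩
            {p : ℝ × GnoCoord L | τ ≤ Real.sqrt (p.2.1.1 1 ^ 2 + p.2.1.1 2 ^ 2)},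
          gnoDeficit z χ (hubAt p.1 1) ε p.2 * Real.exp (-(b * gnoDeficit z χ (hubAt p.1 1) ε p.2))
          ∂((volume : Measure (ℝ × GnoCoord L)).withDensity fun p => ENNReal.ofReal (((1 + p.1 ^ 2)⁻¹) ^ 2 * gnoDensity p.2)) := by
  have hm1 : Measurable fun x : ℍ × GnoCoord L => gnoDeficit z χ x.1 ε x.2 * Real.exp (-(b * gnoDeficit z χ x.1 ε x.2)) :=
    (measurable_gnoDeficit_uncurry z χ ε).mul ((measurable_gnoDeficit_uncurry z χ ε).const_mul b).neg.exp
  have hm2 : Measurable fun p : ℝ × GnoCoord L => gnoDeficit z χ (hubAt p.1 1) ε p.2 * Real.exp (-(b * gnoDeficit z χ (hubAt p.1 1) ε p.2)) :=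
    (measurable_bDeficit z χ ε).mul ((measurable_bDeficit z χ ε).const_mul b).neg.exp
  rw [integral_eq_lintegral_of_nonneg_ae (Filter.Eventually.of_forall fun x => mul_nonneg (gnoDeficit_nonneg _ _ _ _ _) (Real.exp_pos _).le)
      hm1.aestronglyMeasurable.restrict,
    integral_eq_lintegral_of_nonneg_ae (Filter.Eventually.of_forall fun x => mul_nonneg (gnoDeficit_nonneg _ _ _ _ _) (Real.exp_pos _).le)
      hm2.aestronglyMeasurable.restrict]
  have h := setLIntegral_BTube_eq_hubCot z χ ε τ (fun t => ENNReal.ofReal (t * Real.exp (-(b * t)))) (by fun_prop)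
  rw [h, ENNReal.toReal_mul, ENNReal.toReal_ofReal (mul_pos coneConst_pos Real.pi_pos).le]

end Summit.QuantumFields.YangMills.Theorems.SwapVirialDeficit.BlowUpRing

end
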